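import Literature.AlgebraicGeometry.HodgeTheory.LimitMixedHodgeStructureRelativeDual
import Literature.AlgebraicGeometry.HodgeTheory.LimitMixedHodgeStructureRelativeProd
import HarnessLib

/-!
# Duality commutes with direct sums: `(L₁ ⊕ L₂)^∨ ≅ L₁^∨ ⊕ L₂^∨` for (relative) limit mixed Hodge structures

Topic `Literature/AlgebraicGeometry/HodgeTheory` (namespace `Literature.AlgebraicGeometry.HodgeTheory`). A sequel to
`LimitMixedHodgeStructureRelativeDual.lean` (`RelativeLimitMixedHodgeStructure.dual`, `Hom.transpose`) and
`LimitMixedHodgeStructureRelativeProd.lean` (`RelativeLimitMixedHodgeStructure.prod`, `Hom.fst ∕ snd ∕ inl ∕ inr ∕ prodLift ∕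
coprodDesc`), and to the tree's ABSOLUTE `LimitMixedHodgeStructure.dual ∕ prod` and `MixedHodgeStructure.dual ∕ prod`.
DEFINITIONS WITH BODIES and theorems (no named fact, no instance; D-0026 net debt `0`). `V`, `V'` finite-dimensional
over `ℚ`.

The canonical linear isomorphism `V^∨ × V'^∨ ⥲ (V × V')^∨`, `(φ, ψ) ↦ ((v, v') ↦ φ(v) + ψ(v'))` (Mathlib's
`Module.dualProdDualEquivDual`), is `[ᵗπ₁, ᵗπ₂]` — the morphism out of the direct sum `L₁^∨ ⊕ L₂^∨` induced by the
transposes of the two projections `π₁ : L₁ ⊕ L₂ → L₁`, `π₂ : L₁ ⊕ L₂ → L₂` — and its inverse `φ ↦ (φ ∘ ι₁, φ ∘ ι₂)` is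
`⟨ᵗι₁, ᵗι₂⟩`, the morphism into the direct sum induced by the transposes of the two injections. Since transposes,
`[·,·]` and `⟨·,·⟩` of morphisms are morphisms (of MHS: Cattani–El Zein–Griffiths–Lê §3.2.2.7 and Thm. 3.2.18; of limit
MHS and of relative limit MHS: the tree's `Hom.transpose ∕ coprodDesc ∕ prodLift`), BOTH maps are morphisms — of mixed
Hodge structures, of limit mixed Hodge structures (same weight `−k`, intertwining `−ᵗ(N₁ ⊕ N₂)` and `(−ᵗN₁) ⊕ (−ᵗN₂)`),
and of relative limit mixed Hodge structures (respecting `(W^f)^∨`) — i.e. `(L₁ ⊕ L₂)^∨ ≅ L₁^∨ ⊕ L₂^∨` in each of the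
three additive categories («duals … defined in the evident manners», Kato; Deligne (1.6.9): the dual `(V^*, −ᵗN)`).

PRINTED SOURCES, VERBATIM.
* E. Cattani, F. El Zein, P. A. Griffiths, Lê D. T. (eds.), *Hodge Theory* (Math. Notes 49), §3.2.2.7 (held text p0163):
  «In particular, the dual `H^*` of a mixed Hodge structure `H` is an MHS.»; Thm. 3.2.18: «The category of mixed Hodge
  structures is abelian.»; Remark 8.2.2 (p0338): «A morphism of limit MHS is compatible with the filtrations so that we
  have an additive category»; §8.3.2.4 (p0361): the structures `Hom` and tensor product of mixed nilpotent orbits, with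
  «the natural endomorphisms denoted `−Hom(N_1, N'_1), …`».
* P. Deligne, *La conjecture de Weil. II*, (1.6.9): «le dual de `(V', N')` comme étant `(V'^*, −ᵗN')`».
* K. Kato, *On SL(2)-orbit theorems*, Kyoto J. Math. 54 (2014), §2.1, 6: Deligne–Hodge systems «have direct sum, tensor
  products, symmetric powers, exterior powers, duals, and Tate twists, defined in the evident manners.»
* A. Fujiki, *Duality of mixed Hodge structures of algebraic varieties*, Publ. RIMS 16 (1980), (1.6.2) a): the dual MHS.

THIS FILE (all proved):
* §0 (private helper) `(p × q)^⊥` corresponds to `p^⊥ × q^⊥` under `V^∨ × V'^∨ ≅ (V × V')^∨`.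
* §1 Mixed Hodge structures: `MixedHodgeStructure.dualProdHom H₁ H₂ : Hom (H₁^∨ ⊕ H₂^∨) (H₁ ⊕ H₂)^∨ := [ᵗπ₁, ᵗπ₂]`,
  `prodDualHom := ⟨ᵗι₁, ᵗι₂⟩`, their underlying maps (`Module.dualProdDualEquivDual` and its inverse), mutually inverse
  (`prodDualHom_comp_dualProdHom`, `dualProdHom_comp_prodDualHom`), bijective.
* §2 Limit mixed Hodge structures of weight `k` (duals of weight `−k`): `LimitMixedHodgeStructure.dualProdHom ∕ prodDualHom`,
  same API (compositions at the level of linear maps).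
* §3 Relative limit mixed Hodge structures: `RelativeLimitMixedHodgeStructure.dualProdHom ∕ prodDualHom`, mutually inverse
  morphisms of relative limit MHS, bijective; `dual_prod_wf`: `(W^f)^∨_j(L₁ ⊕ L₂)` corresponds to
  `(W^f)^∨_j(L₁) × (W^f)^∨_j(L₂)`; Hodge numbers `h^{p,q}((L₁ ⊕ L₂)^∨) = h^{p,q}(L₁^∨) + h^{p,q}(L₂^∨)`.

## References

* [CattaniElZeinGriffithsLe2014] E. Cattani et al. (eds.), *Hodge Theory*, Math. Notes 49 (2014): §3.2.2.7 (p0163),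
  Thm. 3.2.18, Remark 8.2.2 (p0338), §8.3.2.4 (p0361).
* [Deligne1980] P. Deligne, *La conjecture de Weil. II*, Publ. Math. IHÉS 52 (1980): (1.6.7), Prop. (1.6.9).
* [Fujiki1980] A. Fujiki, *Duality of mixed Hodge structures of algebraic varieties*, Publ. RIMS 16 (1980): (1.6.2).
* [Kato2013] K. Kato, *On SL(2)-orbit theorems*, Kyoto J. Math. 54 (2014) (arXiv:1308.0715): §2.1, 6.
-/

noncomputable section

namespace Literature.AlgebraicGeometry.HodgeTheory

open Motives Motives.MixedHodgeStructure Module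

universe u

variable {V : Type u} [AddCommGroup V] [Module ℚ V] {V' : Type u} [AddCommGroup V'] [Module ℚ V']

/-! ## §0 Annihilators of products -/

/-- **`(p × q)^⊥ ↔ p^⊥ × q^⊥`** under `V^∨ × V'^∨ ≅ (V × V')^∨`, `(φ, ψ) ↦ ((v, v') ↦ φ v + ψ v')`: a pair of forms kills
`p × q` iff `φ` kills `p` and `ψ` kills `q` (private linear-algebra helper for `dual_prod_wf_comap`). [folklore] -/
private theorem dualAnnihilator_prod_comap_dualProdDualEquivDual (p : Submodule ℚ V) (q : Submodule ℚ V') :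
    (p.prod q).dualAnnihilator.comap (dualProdDualEquivDual ℚ V V').toLinearMap =
      p.dualAnnihilator.prod q.dualAnnihilator := by
  ext ⟨φ, ψ⟩
  simp only [Submodule.mem_comap, LinearEquiv.coe_coe, dualProdDualEquivDual_apply, Submodule.mem_dualAnnihilator,
    Submodule.mem_prod, LinearMap.coprod_apply]
  constructor
  · intro h
    refine ⟨fun v hv => ?_, fun w hw => ?_⟩
    · simpa using h (v, 0) ⟨hv, q.zero_mem⟩
    · simpa using h (0, w) ⟨p.zero_mem, hw⟩
  · rintro ⟨h₁, h₂⟩ x ⟨hx₁, hx₂⟩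
    rw [h₁ _ hx₁, h₂ _ hx₂, add_zero]

end Literature.AlgebraicGeometry.HodgeTheory

/-! ## §1 Mixed Hodge structures: `(H₁ ⊕ H₂)^∨ ≅ H₁^∨ ⊕ H₂^∨` -/

namespace Literature.AlgebraicGeometry.Motives.MixedHodgeStructure

open Module

universe u

variable {V : Type u} [AddCommGroup V] [Module ℚ V] {V' : Type u} [AddCommGroup V'] [Module ℚ V']
variable [FiniteDimensional ℚ V] [FiniteDimensional ℚ V'] (H₁ : MixedHodgeStructure V) (H₂ : MixedHodgeStructure V')

/-- **`H₁^∨ ⊕ H₂^∨ → (H₁ ⊕ H₂)^∨`, `(φ, ψ) ↦ φ ∘ π₁ + ψ ∘ π₂`, as a morphism of mixed Hodge structures**: it is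
`[ᵗπ₁, ᵗπ₂]`, the morphism out of the direct sum induced by the transposes of the projections (the category of MHS is
abelian, Thm. 3.2.18; the dual is an MHS, §3.2.2.7). [cite: CattaniElZeinGriffithsLe2014, §3.2.2.7 and Thm. 3.2.18] -/
def dualProdHom : Hom (H₁.dual.prod H₂.dual) (H₁.prod H₂).dual :=
  Hom.coprodDesc (Hom.fst H₁ H₂).transpose (Hom.snd H₁ H₂).transpose

/-- The underlying map of `dualProdHom` is Mathlib's `dualProdDualEquivDual : V^∨ × V'^∨ ≃ (V × V')^∨`.
[cite: CattaniElZeinGriffithsLe2014, §3.2.2.7] -/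
theorem dualProdHom_toLinearMap :
    (dualProdHom H₁ H₂).toLinearMap = (dualProdDualEquivDual ℚ V V').toLinearMap :=
  LinearMap.ext fun _ => LinearMap.ext fun _ => rfl

/-- `dualProdHom (φ, ψ) (v, v') = φ v + ψ v'`. [cite: CattaniElZeinGriffithsLe2014, §3.2.2.7] -/
@[simp]
theorem dualProdHom_apply (χ : Dual ℚ V × Dual ℚ V') (x : V × V') :
    (dualProdHom H₁ H₂).toLinearMap χ x = χ.1 x.1 + χ.2 x.2 :=
  rfl

/-- **`(H₁ ⊕ H₂)^∨ → H₁^∨ ⊕ H₂^∨`, `φ ↦ (φ ∘ ι₁, φ ∘ ι₂)`, as a morphism of mixed Hodge structures**: it is `⟨ᵗι₁, ᵗι₂⟩`,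
the morphism into the direct sum induced by the transposes of the injections. [cite: CattaniElZeinGriffithsLe2014, §3.2.2.7 and Thm. 3.2.18] -/
def prodDualHom : Hom (H₁.prod H₂).dual (H₁.dual.prod H₂.dual) :=
  Hom.prodLift (Hom.inl H₁ H₂).transpose (Hom.inr H₁ H₂).transpose

/-- The underlying map of `prodDualHom` is the inverse of `dualProdDualEquivDual`. [cite: CattaniElZeinGriffithsLe2014, §3.2.2.7] -/
theorem prodDualHom_toLinearMap :
    (prodDualHom H₁ H₂).toLinearMap = (dualProdDualEquivDual ℚ V V').symm.toLinearMap :=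
  LinearMap.ext fun _ => rfl

/-- `prodDualHom φ = (φ ∘ ι₁, φ ∘ ι₂)`. [cite: CattaniElZeinGriffithsLe2014, §3.2.2.7] -/
@[simp]
theorem prodDualHom_apply (φ : Dual ℚ (V × V')) :
    (prodDualHom H₁ H₂).toLinearMap φ = (φ ∘ₗ LinearMap.inl ℚ V V', φ ∘ₗ LinearMap.inr ℚ V V') :=
  rfl

/-- `⟨ᵗι₁, ᵗι₂⟩ ∘ [ᵗπ₁, ᵗπ₂] = id`. [cite: CattaniElZeinGriffithsLe2014, Thm. 3.2.18] -/
theorem prodDualHom_comp_dualProdHom : (prodDualHom H₁ H₂).comp (dualProdHom H₁ H₂) = Hom.id _ :=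
  Hom.ext (by
    rw [Hom.comp_toLinearMap, prodDualHom_toLinearMap, dualProdHom_toLinearMap]
    exact LinearMap.ext (dualProdDualEquivDual ℚ V V').symm_apply_apply)

/-- `[ᵗπ₁, ᵗπ₂] ∘ ⟨ᵗι₁, ᵗι₂⟩ = id`. [cite: CattaniElZeinGriffithsLe2014, Thm. 3.2.18] -/
theorem dualProdHom_comp_prodDualHom : (dualProdHom H₁ H₂).comp (prodDualHom H₁ H₂) = Hom.id _ :=
  Hom.ext (by
    rw [Hom.comp_toLinearMap, prodDualHom_toLinearMap, dualProdHom_toLinearMap]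
    exact LinearMap.ext (dualProdDualEquivDual ℚ V V').apply_symm_apply)

/-- **`H₁^∨ ⊕ H₂^∨ ≅ (H₁ ⊕ H₂)^∨` as mixed Hodge structures**: `dualProdHom` is bijective. [cite: CattaniElZeinGriffithsLe2014, §3.2.2.7 and Thm. 3.2.18] -/
theorem dualProdHom_bijective : Function.Bijective (dualProdHom H₁ H₂).toLinearMap := by
  rw [dualProdHom_toLinearMap]
  exact (dualProdDualEquivDual ℚ V V').bijective

/-- `prodDualHom` is bijective. [cite: CattaniElZeinGriffithsLe2014, §3.2.2.7 and Thm. 3.2.18] -/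
theorem prodDualHom_bijective : Function.Bijective (prodDualHom H₁ H₂).toLinearMap := by
  rw [prodDualHom_toLinearMap]
  exact (dualProdDualEquivDual ℚ V V').symm.bijective

end Literature.AlgebraicGeometry.Motives.MixedHodgeStructure

namespace Literature.AlgebraicGeometry.HodgeTheory

open Motives Motives.MixedHodgeStructure Module

universe u

variable {V : Type u} [AddCommGroup V] [Module ℚ V] {V' : Type u} [AddCommGroup V'] [Module ℚ V']
variable [FiniteDimensional ℚ V] [FiniteDimensional ℚ V']

/-! ## §2 Limit mixed Hodge structures: `(L₁ ⊕ L₂)^∨ ≅ L₁^∨ ⊕ L₂^∨` (weight `−k`) -/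

namespace LimitMixedHodgeStructure

variable {k : ℤ} (L₁ : LimitMixedHodgeStructure V k) (L₂ : LimitMixedHodgeStructure V' k)

/-- **`L₁^∨ ⊕ L₂^∨ → (L₁ ⊕ L₂)^∨ = [ᵗπ₁, ᵗπ₂]` as a morphism of limit mixed Hodge structures of weight `−k`** (it
intertwines `(−ᵗN₁) ⊕ (−ᵗN₂)` and `−ᵗ(N₁ ⊕ N₂)`; Deligne's dual `(V^*, −ᵗN)`).
[cite: Deligne1980, Prop. (1.6.9)] [cite: CattaniElZeinGriffithsLe2014, §3.2.2.7 and §8.3.2.4] -/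
def dualProdHom : Hom (L₁.dual.prod L₂.dual) (L₁.prod L₂).dual :=
  Hom.coprodDesc (Hom.fst L₁ L₂).transpose (Hom.snd L₁ L₂).transpose

/-- The underlying map of `dualProdHom` is `dualProdDualEquivDual`. [cite: Deligne1980, Prop. (1.6.9)] -/
theorem dualProdHom_toLinearMap :
    (dualProdHom L₁ L₂).toLinearMap = (dualProdDualEquivDual ℚ V V').toLinearMap :=
  LinearMap.ext fun _ => LinearMap.ext fun _ => rfl

/-- `dualProdHom (φ, ψ) (v, v') = φ v + ψ v'`. [cite: Deligne1980, Prop. (1.6.9)] -/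
@[simp]
theorem dualProdHom_apply (χ : Dual ℚ V × Dual ℚ V') (x : V × V') :
    (dualProdHom L₁ L₂).toLinearMap χ x = χ.1 x.1 + χ.2 x.2 :=
  rfl

/-- **`(L₁ ⊕ L₂)^∨ → L₁^∨ ⊕ L₂^∨ = ⟨ᵗι₁, ᵗι₂⟩` as a morphism of limit mixed Hodge structures of weight `−k`.**
[cite: Deligne1980, Prop. (1.6.9)] [cite: CattaniElZeinGriffithsLe2014, §3.2.2.7 and §8.3.2.4] -/
def prodDualHom : Hom (L₁.prod L₂).dual (L₁.dual.prod L₂.dual) :=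
  Hom.prodLift (Hom.inl L₁ L₂).transpose (Hom.inr L₁ L₂).transpose

/-- The underlying map of `prodDualHom` is the inverse of `dualProdDualEquivDual`. [cite: Deligne1980, Prop. (1.6.9)] -/
theorem prodDualHom_toLinearMap :
    (prodDualHom L₁ L₂).toLinearMap = (dualProdDualEquivDual ℚ V V').symm.toLinearMap :=
  LinearMap.ext fun _ => rfl

/-- `prodDualHom φ = (φ ∘ ι₁, φ ∘ ι₂)`. [cite: Deligne1980, Prop. (1.6.9)] -/
@[simp]
theorem prodDualHom_apply (φ : Dual ℚ (V × V')) :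
    (prodDualHom L₁ L₂).toLinearMap φ = (φ ∘ₗ LinearMap.inl ℚ V V', φ ∘ₗ LinearMap.inr ℚ V V') :=
  rfl

/-- `⟨ᵗι₁, ᵗι₂⟩ ∘ [ᵗπ₁, ᵗπ₂] = id` on vectors. [cite: Deligne1980, Prop. (1.6.9)] -/
theorem prodDualHom_toLinearMap_comp_dualProdHom :
    (prodDualHom L₁ L₂).toLinearMap ∘ₗ (dualProdHom L₁ L₂).toLinearMap = LinearMap.id := by
  rw [prodDualHom_toLinearMap, dualProdHom_toLinearMap]
  exact LinearMap.ext (dualProdDualEquivDual ℚ V V').symm_apply_apply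

/-- `[ᵗπ₁, ᵗπ₂] ∘ ⟨ᵗι₁, ᵗι₂⟩ = id` on vectors. [cite: Deligne1980, Prop. (1.6.9)] -/
theorem dualProdHom_toLinearMap_comp_prodDualHom :
    (dualProdHom L₁ L₂).toLinearMap ∘ₗ (prodDualHom L₁ L₂).toLinearMap = LinearMap.id := by
  rw [prodDualHom_toLinearMap, dualProdHom_toLinearMap]
  exact LinearMap.ext (dualProdDualEquivDual ℚ V V').apply_symm_apply

/-- **`L₁^∨ ⊕ L₂^∨ ≅ (L₁ ⊕ L₂)^∨` as limit mixed Hodge structures**: `dualProdHom` is bijective.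
[cite: Deligne1980, Prop. (1.6.9)] [cite: CattaniElZeinGriffithsLe2014, §3.2.2.7 and Thm. 3.2.18] -/
theorem dualProdHom_bijective : Function.Bijective (dualProdHom L₁ L₂).toLinearMap := by
  rw [dualProdHom_toLinearMap]
  exact (dualProdDualEquivDual ℚ V V').bijective

/-- `prodDualHom` is bijective. [cite: Deligne1980, Prop. (1.6.9)] -/
theorem prodDualHom_bijective : Function.Bijective (prodDualHom L₁ L₂).toLinearMap := by
  rw [prodDualHom_toLinearMap]
  exact (dualProdDualEquivDual ℚ V V').symm.bijective

end LimitMixedHodgeStructure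

/-! ## §3 Relative limit mixed Hodge structures: `(L₁ ⊕ L₂)^∨ ≅ L₁^∨ ⊕ L₂^∨` -/

namespace RelativeLimitMixedHodgeStructure

variable (L₁ : RelativeLimitMixedHodgeStructure V) (L₂ : RelativeLimitMixedHodgeStructure V')

/-- **`L₁^∨ ⊕ L₂^∨ → (L₁ ⊕ L₂)^∨ = [ᵗπ₁, ᵗπ₂]` as a morphism of relative limit mixed Hodge structures**: it maps
`(W^f₁)^∨_j × (W^f₂)^∨_j = (W^f₁_{−1−j})^⊥ × (W^f₂_{−1−j})^⊥` into `((W^f₁ × W^f₂)_{−1−j})^⊥ = (W^f)^∨_j(L₁ ⊕ L₂)` and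
intertwines `(−ᵗN₁) ⊕ (−ᵗN₂)` and `−ᵗ(N₁ ⊕ N₂)` («duals … defined in the evident manners»).
[cite: Kato2013, §2.1, 6] [cite: CattaniElZeinGriffithsLe2014, Remark 8.2.2 and §3.2.2.7] [cite: Deligne1980, Prop. (1.6.9)] -/
def dualProdHom : Hom (L₁.dual.prod L₂.dual) (L₁.prod L₂).dual :=
  Hom.coprodDesc (Hom.fst L₁ L₂).transpose (Hom.snd L₁ L₂).transpose

/-- The underlying map of `dualProdHom` is `dualProdDualEquivDual`. [cite: Kato2013, §2.1, 6] -/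
theorem dualProdHom_toLinearMap :
    (dualProdHom L₁ L₂).toLinearMap = (dualProdDualEquivDual ℚ V V').toLinearMap :=
  LinearMap.ext fun _ => LinearMap.ext fun _ => rfl

/-- `dualProdHom (φ, ψ) (v, v') = φ v + ψ v'`. [cite: Kato2013, §2.1, 6] -/
@[simp]
theorem dualProdHom_apply (χ : Dual ℚ V × Dual ℚ V') (x : V × V') :
    (dualProdHom L₁ L₂).toLinearMap χ x = χ.1 x.1 + χ.2 x.2 :=
  rfl

/-- **`(L₁ ⊕ L₂)^∨ → L₁^∨ ⊕ L₂^∨ = ⟨ᵗι₁, ᵗι₂⟩` as a morphism of relative limit mixed Hodge structures.**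
[cite: Kato2013, §2.1, 6] [cite: CattaniElZeinGriffithsLe2014, Remark 8.2.2 and §3.2.2.7] [cite: Deligne1980, Prop. (1.6.9)] -/
def prodDualHom : Hom (L₁.prod L₂).dual (L₁.dual.prod L₂.dual) :=
  Hom.prodLift (Hom.inl L₁ L₂).transpose (Hom.inr L₁ L₂).transpose

/-- The underlying map of `prodDualHom` is the inverse of `dualProdDualEquivDual`. [cite: Kato2013, §2.1, 6] -/
theorem prodDualHom_toLinearMap :
    (prodDualHom L₁ L₂).toLinearMap = (dualProdDualEquivDual ℚ V V').symm.toLinearMap :=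
  LinearMap.ext fun _ => rfl

/-- `prodDualHom φ = (φ ∘ ι₁, φ ∘ ι₂)`. [cite: Kato2013, §2.1, 6] -/
@[simp]
theorem prodDualHom_apply (φ : Dual ℚ (V × V')) :
    (prodDualHom L₁ L₂).toLinearMap φ = (φ ∘ₗ LinearMap.inl ℚ V V', φ ∘ₗ LinearMap.inr ℚ V V') :=
  rfl

/-- `⟨ᵗι₁, ᵗι₂⟩ ∘ [ᵗπ₁, ᵗπ₂] = id`. [cite: Kato2013, §2.1, 6] -/
theorem prodDualHom_comp_dualProdHom : (prodDualHom L₁ L₂).comp (dualProdHom L₁ L₂) = Hom.id _ :=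
  Hom.ext (by
    rw [Hom.comp_toLinearMap, prodDualHom_toLinearMap, dualProdHom_toLinearMap]
    exact LinearMap.ext (dualProdDualEquivDual ℚ V V').symm_apply_apply)

/-- `[ᵗπ₁, ᵗπ₂] ∘ ⟨ᵗι₁, ᵗι₂⟩ = id`. [cite: Kato2013, §2.1, 6] -/
theorem dualProdHom_comp_prodDualHom : (dualProdHom L₁ L₂).comp (prodDualHom L₁ L₂) = Hom.id _ :=
  Hom.ext (by
    rw [Hom.comp_toLinearMap, prodDualHom_toLinearMap, dualProdHom_toLinearMap]
    exact LinearMap.ext (dualProdDualEquivDual ℚ V V').apply_symm_apply)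

/-- **`L₁^∨ ⊕ L₂^∨ ≅ (L₁ ⊕ L₂)^∨` as relative limit mixed Hodge structures**: `dualProdHom` is bijective (with inverse
the morphism `prodDualHom`). [cite: Kato2013, §2.1, 6] [cite: CattaniElZeinGriffithsLe2014, Remark 8.2.2 and Thm. 3.2.18] -/
theorem dualProdHom_bijective : Function.Bijective (dualProdHom L₁ L₂).toLinearMap := by
  rw [dualProdHom_toLinearMap]
  exact (dualProdDualEquivDual ℚ V V').bijective

/-- `prodDualHom` is bijective. [cite: Kato2013, §2.1, 6] -/
theorem prodDualHom_bijective : Function.Bijective (prodDualHom L₁ L₂).toLinearMap := by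
  rw [prodDualHom_toLinearMap]
  exact (dualProdDualEquivDual ℚ V V').symm.bijective

/-- **The finite weight filtrations correspond**: `(W^f)^∨_j(L₁ ⊕ L₂) = ((W^f₁ × W^f₂)_{−1−j})^⊥` pulls back under
`V^∨ × V'^∨ ≅ (V × V')^∨` to `(W^f₁_{−1−j})^⊥ × (W^f₂_{−1−j})^⊥ = (W^f)^∨_j(L₁) × (W^f)^∨_j(L₂)`.
[cite: Kato2013, §2.1, 6] [cite: Deligne1980, Prop. (1.6.9) (ii)] -/
theorem dual_prod_wf_comap (j : ℤ) :
    ((L₁.prod L₂).dual.wf j).comap (dualProdDualEquivDual ℚ V V').toLinearMap =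
      (L₁.dual.prod L₂.dual).wf j := by
  rw [dual_wf, prod_wf, prod_wf, dual_wf, dual_wf]
  exact dualAnnihilator_prod_comap_dualProdDualEquivDual (L₁.wf (-1 - j)) (L₂.wf (-1 - j))

/-- The same correspondence as an image: `dualProdHom` maps `(W^f)^∨_j(L₁) × (W^f)^∨_j(L₂)` ONTO `(W^f)^∨_j(L₁ ⊕ L₂)`.
[cite: Kato2013, §2.1, 6] -/
theorem map_dualProdHom_wf (j : ℤ) :
    ((L₁.dual.prod L₂.dual).wf j).map (dualProdHom L₁ L₂).toLinearMap = (L₁.prod L₂).dual.wf j := by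
  rw [← dual_prod_wf_comap, dualProdHom_toLinearMap, Submodule.map_comap_eq_of_surjective]
  exact (dualProdDualEquivDual ℚ V V').surjective

/-- **`h^{p,q}((L₁ ⊕ L₂)^∨) = h^{p,q}(L₁^∨) + h^{p,q}(L₂^∨)`.** [cite: CattaniElZeinGriffithsLe2014, §3.2.2.7] -/
theorem hodgeNumber_dual_prod (p q : ℤ) :
    (L₁.prod L₂).dual.toMixedHodgeStructure.hodgeNumber p q =
      L₁.dual.toMixedHodgeStructure.hodgeNumber p q + L₂.dual.toMixedHodgeStructure.hodgeNumber p q := by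
  rw [← (dualProdHom L₁ L₂).toHom.hodgeNumber_eq_of_bijective (dualProdHom_bijective L₁ L₂) p q]
  exact hodgeNumber_prod L₁.dual L₂.dual p q

end RelativeLimitMixedHodgeStructure

end Literature.AlgebraicGeometry.HodgeTheory

end
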